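import Mathlib
import Literature.Algebra.GroupRings.Gardam2021.Promislow

/-! # Gardam's counterexample to the Kaplansky unit conjecture, in Mathlib's `MonoidAlgebra` vocabulary

Gardam, *A counterexample to the unit conjecture for group rings*, Ann. of Math. (2) 194 (2021) 967–979,
Theorem A: for the Promislow group `P` (a torsion-free group) the group ring `𝔽₂[P]` has a unit that is
not of the form `k·g` (`k ∈ 𝔽₂ˣ`, `g ∈ P`), refuting Kaplansky's unit conjecture.

`Promislow.lean` verifies Gardam's identity `α α' = α' α = 1` by kernel computation in a home-made
calculus of `𝔽₂[P]`-elements as LISTS of group elements (`coeff`, `lmul`, `equiv`).  This file proves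
that the list calculus AGREES with Mathlib's monoid algebra `MonoidAlgebra (ZMod 2) PElt` (the map
`toMonoidAlgebra` sends `lmul` to `*`, and `equiv` to equality), and restates Theorem A in that
vocabulary: `gardamUnit : (MonoidAlgebra (ZMod 2) PElt)ˣ` is not a monomial `single g c`, and the
model `PElt` of `P` has no non-trivial element of finite order.  We also record that the STRONGER
Mathlib class `IsMulTorsionFree` (injectivity of `g ↦ g ^ n`) fails for `P` — `a² = (y·a)² = x` —
so "torsion-free" in the unit conjecture is the order notion, not `IsMulTorsionFree`. -/

namespace Literature.Algebra.GroupRings.Promislow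

open MonoidAlgebra

/-! ## The list calculus agrees with `MonoidAlgebra (ZMod 2) PElt` -/

/-- The element of `𝔽₂[P]` represented by a list of group elements: `Σ_{g ∈ l} 1·g`
(multiplicities add up in `ZMod 2`). [cite: Gardam2021, §3.1] -/
noncomputable def toMonoidAlgebra (l : List PElt) : MonoidAlgebra (ZMod 2) PElt :=
  (l.map fun g => MonoidAlgebra.single g (1 : ZMod 2)).sum

/-- `toMonoidAlgebra [] = 0`. [folklore] -/
@[simp] private theorem toMonoidAlgebra_nil : toMonoidAlgebra [] = 0 := by
  simp [toMonoidAlgebra]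

/-- `toMonoidAlgebra (g :: l) = g + toMonoidAlgebra l`. [folklore] -/
@[simp] private theorem toMonoidAlgebra_cons (g : PElt) (l : List PElt) :
    toMonoidAlgebra (g :: l) = MonoidAlgebra.single g 1 + toMonoidAlgebra l := by
  simp [toMonoidAlgebra]

/-- `toMonoidAlgebra` is additive in list concatenation. [folklore] -/
private theorem toMonoidAlgebra_append (l m : List PElt) :
    toMonoidAlgebra (l ++ m) = toMonoidAlgebra l + toMonoidAlgebra m := by
  simp [toMonoidAlgebra, List.map_append, List.sum_append]

/-- AGREEMENT: the coefficient of `g` in `toMonoidAlgebra l` (Mathlib's `MonoidAlgebra.coeff`) is the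
multiplicity of `g` in `l` read in `ZMod 2` — i.e. `Promislow.coeff l g = true` iff the coefficient is `1`;
this is the reading of group-ring elements over `𝔽₂` used in Gardam's computer verification. [cite: Gardam2021, proof of Thm A] -/
theorem coeff_toMonoidAlgebra (l : List PElt) (g : PElt) :
    (toMonoidAlgebra l).coeff g = ((l.count g : ℕ) : ZMod 2) := by
  induction l with
  | nil => simp
  | cons h t ih =>
      rw [toMonoidAlgebra_cons, coeff_add, Finsupp.add_apply, ih, coeff_single, Finsupp.single_apply,
        List.count_cons]
      by_cases hh : h = g
      · subst hh; simp [add_comm]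
      · have : (h == g) = false := by simpa using hh
        simp [hh, this]

/-- Left multiplication by a group element commutes with `toMonoidAlgebra`. [folklore] -/
private theorem toMonoidAlgebra_map_mul (g : PElt) (m : List PElt) :
    toMonoidAlgebra (m.map fun h => g * h) = MonoidAlgebra.single g 1 * toMonoidAlgebra m := by
  induction m with
  | nil => simp
  | cons h t ih =>
      rw [List.map_cons, toMonoidAlgebra_cons, toMonoidAlgebra_cons, ih, mul_add, single_mul_single, mul_one]

/-- AGREEMENT: the list product `lmul` is the product of the group ring `𝔽₂[P] = MonoidAlgebra (ZMod 2) PElt`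
(the finite computation by which Gardam verifies `α α' = α' α = 1`). [cite: Gardam2021, proof of Thm A] -/
theorem toMonoidAlgebra_lmul (l m : List PElt) :
    toMonoidAlgebra (lmul l m) = toMonoidAlgebra l * toMonoidAlgebra m := by
  unfold lmul
  induction l with
  | nil => simp
  | cons g t ih =>
      rw [List.flatMap_cons, toMonoidAlgebra_append, toMonoidAlgebra_map_mul, ih, toMonoidAlgebra_cons,
        add_mul]

/-- AGREEMENT: `equiv l m = true` implies equality in `MonoidAlgebra (ZMod 2) PElt`. [cite: Gardam2021, proof of Thm A] -/
theorem toMonoidAlgebra_eq_of_equiv {l m : List PElt} (h : equiv l m = true) :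
    toMonoidAlgebra l = toMonoidAlgebra m := by
  unfold equiv at h
  rw [List.all_eq_true] at h
  ext g
  rw [coeff_toMonoidAlgebra, coeff_toMonoidAlgebra]
  by_cases hg : g ∈ l ++ m
  · have hc := h g hg
    unfold coeff at hc
    rw [ZMod.natCast_eq_natCast_iff']
    rcases Nat.mod_two_eq_zero_or_one (l.count g) with h1 | h1 <;>
      rcases Nat.mod_two_eq_zero_or_one (m.count g) with h2 | h2 <;>
      simp_all
  · rw [List.mem_append, not_or] at hg
    rw [List.count_eq_zero_of_not_mem hg.1, List.count_eq_zero_of_not_mem hg.2]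

/-- The converse agreement: equality in `MonoidAlgebra (ZMod 2) PElt` implies `equiv l m = true`, so `equiv` IS
equality of group-ring elements. [cite: Gardam2021, proof of Thm A] -/
theorem equiv_of_toMonoidAlgebra_eq {l m : List PElt} (h : toMonoidAlgebra l = toMonoidAlgebra m) :
    equiv l m = true := by
  unfold equiv
  rw [List.all_eq_true]
  intro g _
  have hc : ((l.count g : ℕ) : ZMod 2) = ((m.count g : ℕ) : ZMod 2) := by
    rw [← coeff_toMonoidAlgebra, ← coeff_toMonoidAlgebra, h]
  rw [ZMod.natCast_eq_natCast_iff'] at hc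
  unfold coeff
  simp [hc]

/-- `toMonoidAlgebra [1] = 1`. [folklore] -/
private theorem toMonoidAlgebra_one : toMonoidAlgebra [1] = 1 := by
  simp [MonoidAlgebra.one_def]

/-! ## Gardam's unit as a unit of `MonoidAlgebra (ZMod 2) PElt` -/

/-- Gardam's unit `α = p + q a + r b + s ab ∈ 𝔽₂[P]` with inverse `α'`, as an element of
`(MonoidAlgebra (ZMod 2) PElt)ˣ`; both identities are the kernel computations of `Promislow.lean`
transported by the agreement lemmas. [cite: Gardam2021, Thm A] -/
noncomputable def gardamUnit : (MonoidAlgebra (ZMod 2) PElt)ˣ where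
  val := toMonoidAlgebra alpha
  inv := toMonoidAlgebra alpha'
  val_inv := by rw [← toMonoidAlgebra_lmul, toMonoidAlgebra_eq_of_equiv alpha_mul_alpha', toMonoidAlgebra_one]
  inv_val := by rw [← toMonoidAlgebra_lmul, toMonoidAlgebra_eq_of_equiv alpha'_mul_alpha, toMonoidAlgebra_one]

/-- The identity `1 = x⁰y⁰z⁰` and `x` both occur in `α` with multiplicity one. [folklore] -/
private theorem alpha_count_one_x : alpha.count (mono 0 0 0) = 1 ∧ alpha.count (mono 1 0 0) = 1 := by decide

/-- Gardam's unit is NON-TRIVIAL: it is not a monomial `c·g`. [cite: Gardam2021, Thm A] -/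
theorem gardamUnit_ne_single (g : PElt) (c : ZMod 2) :
    (gardamUnit : MonoidAlgebra (ZMod 2) PElt) ≠ MonoidAlgebra.single g c := by
  intro h
  have h1 : (toMonoidAlgebra alpha).coeff (mono 0 0 0) = 1 := by
    rw [coeff_toMonoidAlgebra, alpha_count_one_x.1]; simp
  have h2 : (toMonoidAlgebra alpha).coeff (mono 1 0 0) = 1 := by
    rw [coeff_toMonoidAlgebra, alpha_count_one_x.2]; simp
  change toMonoidAlgebra alpha = MonoidAlgebra.single g c at h
  rw [h, coeff_single, Finsupp.single_apply] at h1 h2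
  split_ifs at h1 h2 with hg1 hg2
  · exact absurd (hg1.symm.trans hg2) (by decide)
  · exact zero_ne_one h2
  · exact zero_ne_one h1
  · exact zero_ne_one h1

/-! ## `P` is torsion-free (no non-trivial element of finite order) -/

/-- Product of two Laurent monomials. [folklore] -/
private theorem mono_mul_mono (i j k i' j' k' : ℤ) :
    mono i j k * mono i' j' k' = mono (i + i') (j + j') (k + k') := by
  show mul (mono i j k) (mono i' j' k') = _
  ext <;> simp [mul, mono, act, sgn, coc_one_left]

/-- Powers of a Laurent monomial. [folklore] -/
private theorem mono_pow (i j k : ℤ) (n : ℕ) : mono i j k ^ n = mono (n * i) (n * j) (n * k) := by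
  induction n with
  | zero => simp; rfl
  | succ n ih => rw [pow_succ, ih, mono_mul_mono]; push_cast; congr 1 <;> ring

/-- The square of every element of `P` is a Laurent monomial: a translation squares coordinatewise,
`(v·a)² = x^{2v₁+1}`, `(v·b)² = y^{2v₂+1}`, `(v·ab)² = z^{2v₃+1}`. [folklore] -/
private theorem sq_eq_mono (u : PElt) :
    u * u = (match u.s, u.t with
      | false, false => mono (2 * u.x) (2 * u.y) (2 * u.z)
      | true, false => mono (2 * u.x + 1) 0 0
      | false, true => mono 0 (2 * u.y + 1) 0
      | true, true => mono 0 0 (2 * u.z + 1)) := by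
  obtain ⟨x, y, z, s, t⟩ := u
  show mul _ _ = _
  cases s <;> cases t <;> (ext <;> simp [mul, mono, act, sgn, coc] <;> ring)

/-- `mono i j k = 1 ↔ i = j = k = 0`. [folklore] -/
private theorem mono_eq_one_iff (i j k : ℤ) : mono i j k = 1 ↔ i = 0 ∧ j = 0 ∧ k = 0 := by
  constructor
  · intro h
    have h' := PElt.ext_iff.1 h
    simp only [mono] at h'
    exact ⟨h'.1, h'.2.1, h'.2.2.1⟩
  · rintro ⟨rfl, rfl, rfl⟩; rfl

/-- TORSION-FREENESS of `P` in the model `PElt`: an element with a positive power equal to `1` is `1`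
(so `P` has no non-trivial element of finite order). [cite: Gardam2021, §3.1] -/
theorem eq_one_of_pow_eq_one (g : PElt) (n : ℕ) (hn : 0 < n) (hgn : g ^ n = 1) : g = 1 := by
  have h2 : (g * g) ^ n = 1 := by rw [← pow_two, ← pow_mul, mul_comm, pow_mul, hgn, one_pow]
  have hn' : (n : ℤ) ≠ 0 := by exact_mod_cast hn.ne'
  rw [sq_eq_mono] at h2
  obtain ⟨x, y, z, s, t⟩ := g
  cases s <;> cases t <;> simp only at h2 <;> rw [mono_pow, mono_eq_one_iff] at h2
  · obtain ⟨hx, hy, hz⟩ := h2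
    have hx' : x = 0 := by
      rcases mul_eq_zero.1 hx with h | h
      · exact absurd h hn'
      · omega
    have hy' : y = 0 := by
      rcases mul_eq_zero.1 hy with h | h
      · exact absurd h hn'
      · omega
    have hz' : z = 0 := by
      rcases mul_eq_zero.1 hz with h | h
      · exact absurd h hn'
      · omega
    subst hx' hy' hz'; rfl
  · obtain ⟨-, hy, -⟩ := h2
    rcases mul_eq_zero.1 hy with h | h
    · exact absurd h hn'
    · omega
  · obtain ⟨hx, -, -⟩ := h2
    rcases mul_eq_zero.1 hx with h | h
    · exact absurd h hn'
    · omega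
  · obtain ⟨-, -, hz⟩ := h2
    rcases mul_eq_zero.1 hz with h | h
    · exact absurd h hn'
    · omega

/-- `P` has no non-trivial element of finite order (the torsion-freeness hypothesis of the unit
conjecture, in Mathlib's `IsOfFinOrder` vocabulary). [cite: Gardam2021, §3.1] -/
theorem not_isOfFinOrder (g : PElt) (hg : g ≠ 1) : ¬ IsOfFinOrder g := by
  rw [isOfFinOrder_iff_pow_eq_one]
  rintro ⟨n, hn, hgn⟩
  exact hg (eq_one_of_pow_eq_one g n hn hgn)

/-- The stronger Mathlib class `IsMulTorsionFree` (injectivity of `g ↦ g ^ n`, `n ≠ 0`) FAILS for `P`: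
`a ≠ y·a` but `a² = (y·a)² = x`.  (For groups that are not commutative "torsion-free" in Kaplansky's
conjectures means `not_isOfFinOrder`, not unique roots.) [cite: Gardam2021, §3.1] -/
theorem not_isMulTorsionFree : ¬ IsMulTorsionFree PElt := by
  intro h
  have hsq : a ^ 2 = (y * a) ^ 2 := by decide
  have hne : a ≠ y * a := by decide
  exact hne (h.pow_left_injective (by norm_num) hsq)

/-! ## Theorem A -/

/-- **Gardam 2021, Theorem A** (counterexample to the Kaplansky unit conjecture) for the model `PElt` of the
Promislow group and the field `𝔽₂ = ZMod 2`: `P` has no non-trivial element of finite order, and the group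
ring `𝔽₂[P] = MonoidAlgebra (ZMod 2) PElt` has a unit which is not of the form `c·g`. [cite: Gardam2021, Thm A] -/
theorem Gardam2021_theoremA :
    (∀ g : PElt, g ≠ 1 → ¬ IsOfFinOrder g) ∧
      ∃ u : (MonoidAlgebra (ZMod 2) PElt)ˣ, ∀ (g : PElt) (c : ZMod 2),
        (u : MonoidAlgebra (ZMod 2) PElt) ≠ MonoidAlgebra.single g c :=
  ⟨not_isOfFinOrder, gardamUnit, gardamUnit_ne_single⟩

/-! ## The zero-divisor certificate predicate agrees with zero divisors of `MonoidAlgebra (ZMod 2) PElt`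

(appended 2026-08-21, ops-runbook) `IsZeroDivisorPair l m` is the checker a SAT hit would be verified against
(`Promislow.lean`); it says exactly that the two group-ring elements are non-zero with product zero. -/

/-- A list represents a NON-ZERO element of `𝔽₂[P]` iff some entry has odd multiplicity (`l.any (coeff l)`). [cite: Gardam2021, proof of Thm A] -/
theorem any_coeff_iff_toMonoidAlgebra_ne_zero (l : List PElt) :
    l.any (coeff l) = true ↔ toMonoidAlgebra l ≠ 0 := by
  rw [List.any_eq_true]
  constructor
  · rintro ⟨g, -, hg⟩ h0
    have hc : (toMonoidAlgebra l).coeff g = ((l.count g : ℕ) : ZMod 2) := coeff_toMonoidAlgebra l g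
    rw [h0, coeff_zero, Finsupp.zero_apply] at hc
    unfold coeff at hg
    have h1 : l.count g % 2 = 1 := by simpa using hg
    have h2 := (ZMod.natCast_eq_natCast_iff' 0 (l.count g) 2).1 (by simpa using hc)
    omega
  · intro h
    have h' : (toMonoidAlgebra l).coeff ≠ 0 := fun hc => h (coeff_eq_zero.1 hc)
    obtain ⟨g, hg⟩ := Finsupp.ne_iff.1 h'
    rw [Finsupp.zero_apply, coeff_toMonoidAlgebra] at hg
    have hodd : l.count g % 2 = 1 := by
      rcases Nat.mod_two_eq_zero_or_one (l.count g) with h0 | h1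
      · exact absurd ((ZMod.natCast_eq_natCast_iff' (l.count g) 0 2).2 (by simpa using h0)) (by simpa using hg)
      · exact h1
    refine ⟨g, List.count_pos_iff.1 (by omega), ?_⟩
    unfold coeff
    simpa using hodd

/-- AGREEMENT: `IsZeroDivisorPair l m = true` iff `l`, `m` represent NON-ZERO elements of `𝔽₂[P] = MonoidAlgebra (ZMod 2) PElt`
with PRODUCT ZERO — the certificate predicate is exactly "zero-divisor pair in the group ring" in Mathlib's sense. [cite: Gardam2021, proof of Thm A] -/
theorem isZeroDivisorPair_iff (l m : List PElt) :
    IsZeroDivisorPair l m = true ↔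
      toMonoidAlgebra l ≠ 0 ∧ toMonoidAlgebra m ≠ 0 ∧ toMonoidAlgebra l * toMonoidAlgebra m = 0 := by
  unfold IsZeroDivisorPair
  rw [Bool.and_eq_true, Bool.and_eq_true, any_coeff_iff_toMonoidAlgebra_ne_zero, any_coeff_iff_toMonoidAlgebra_ne_zero,
    ← toMonoidAlgebra_lmul, and_assoc]
  have h0 : toMonoidAlgebra ([] : List PElt) = 0 := toMonoidAlgebra_nil
  constructor
  · rintro ⟨hl, hm, he⟩
    exact ⟨hl, hm, by rw [toMonoidAlgebra_eq_of_equiv he, h0]⟩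
  · rintro ⟨hl, hm, he⟩
    exact ⟨hl, hm, equiv_of_toMonoidAlgebra_eq (by rw [he, h0])⟩

/-- Consequence: Gardam's `α`, being a unit, is not a zero divisor in `𝔽₂[P]` — the Mathlib-side reading of `not_zd_alpha`. [cite: Gardam2021, Thm A] -/
theorem gardamUnit_mul_ne_zero (x : MonoidAlgebra (ZMod 2) PElt) (hx : x ≠ 0) :
    (gardamUnit : MonoidAlgebra (ZMod 2) PElt) * x ≠ 0 := by
  intro h
  exact hx (by simpa using congrArg (fun y => (↑gardamUnit⁻¹ : MonoidAlgebra (ZMod 2) PElt) * y) h)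

end Literature.Algebra.GroupRings.Promislow
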